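import Summits.BirchSwinnertonDyer.Rank2.LambdaTransportDoorAtTwo
import Summits.BirchSwinnertonDyer.Rank2.TwoAdicLambdaTransportKernel
import Literature.NumberTheory.EllipticCurves.ComplexMultiplicationRationalJIntegralProofs
import HarnessLib

/-!
# Door (F*) at `p = 2`: the support `MembersNonCM` HOLDS — no admissible member of the `8-15-17` family has CM
# (its `j`-invariant has the prime `r = m + 289n²` to the power `2` in the denominator)

Cell `bsd-rank2`, seat `bsd-rank2-eng-2` GEN 4; follow-up of the banked door `Rank2/LambdaTransportDoorAtTwo.lean`
(p503607) and its proofs (p504094, p505328), director-bsd g7 ruling (D′) refined 05:53:24Z (c) («certify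
`RootNumberFacts` / `ReferenceFacts` / `MembersNonCM`»). Of the displayed inputs of the outcome-of-record theorem
`LambdaTransportDoor.selmerCorankEqOrderEqThreeOnOddFamily_of_19272`, the pack **`MembersNonCM`**
(`∀ j n, AdmissibleF j n → ∀ (_ : (curve j n).IsElliptic), ¬ (curve j n).HasCM`) is PROVED here, unconditionally:

* `Family81517.curve_c₄`, `curve_Δ`, `curve_j` — for `E = curve j n = ⟨1, A, 0, qr, 0⟩` (`4A = −17q − 1`):
  `c₄ = q(289q − 48r)`, `Δ = 225 m q³ r²`, `j(E) = q³(289q − 48r)³ / (225 m q³ r²)`, and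
  `289q − 48r = 241m + 4624n² > 0`;
* `Family81517.padicValRat_j_eq_neg_two` — for admissible `(j, n)` the prime `r` divides neither `q`, nor `m`,
  nor `225`, nor `289q − 48r` (else `r ∣ 289q`, but `r > 289` and `r ≠ q`), so `v_r(j(E)) = 0 − 2 = −2`;
* `Family81517.one_lt_norm_j` — `‖j(E)‖_r = r² > 1`;
* **`LambdaTransportDoor.membersNonCM_holds : MembersNonCM`** — by the tree theorem
  `WeierstrassCurve.not_hasCM_of_one_lt_norm_j` (a CM curve over `ℚ` has integral `j`; Silverman *ATAEC* II.6.1,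
  *AEC* VII.5.5), itself unconditional in the tree.

THEOREMS ONLY (no definition, no named fact, no `sorry`). PARTITION: none — r_an ≥ 2, summit axis S0;
TWIN (D-0056): n/a. B1 honesty: elementary arithmetic of an explicit model; no S0 motion.

References: J. H. Silverman, *Advanced Topics in the Arithmetic of Elliptic Curves* (1994) Thm. II.6.1
[SilvermanATAEC1994]; *AEC* (2009) Prop. VII.5.5, III §1 (c₄, Δ, j) [SilvermanAEC2009].
-/

set_option linter.dupNamespace false

noncomputable section

open WeierstrassCurve Literature.NumberTheory.EllipticCurves

namespace Summit.BirchSwinnertonDyer.Rank2.Family81517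

/-! ### §1 `c₄`, `Δ` and `j` of the member `curve j n` -/

/-- `c₄(E_{m,n}) = q (289 q − 48 r)` for the `a₁ = 1` model `⟨1, A, 0, qr, 0⟩`, `4A = −17q − 1`
(`b₂ = −17q`, `b₄ = 2qr`). [cite: SilvermanAEC2009, III §1 (b₂, b₄, c₄)] -/
theorem curve_c₄ (j n : ℤ) :
    (curve j n).c₄ = ((qOf j n * (289 * qOf j n - 48 * rOf j n) : ℤ) : ℚ) := by
  simp only [curve, WeierstrassCurve.c₄, WeierstrassCurve.b₂, WeierstrassCurve.b₄, qOf, rOf]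
  push_cast
  ring

/-- `Δ(E_{m,n}) = 225 m q³ r²` (`289 q − 64 r = 225 m`). [cite: SilvermanAEC2009, III §1 (Δ)] -/
theorem curve_Δ (j n : ℤ) :
    (curve j n).Δ = ((225 * mOf j * qOf j n ^ 3 * rOf j n ^ 2 : ℤ) : ℚ) := by
  simp only [curve, WeierstrassCurve.Δ, WeierstrassCurve.b₂, WeierstrassCurve.b₄, WeierstrassCurve.b₆,
    WeierstrassCurve.b₈, qOf, rOf, mOf]
  push_cast
  ring

/-- `289 q − 48 r = 241 m + 4624 n²`. [folklore] -/
theorem sub_eq_lin (j n : ℤ) : 289 * qOf j n - 48 * rOf j n = 241 * mOf j + 4624 * n ^ 2 := by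
  unfold qOf rOf mOf; ring

/-- **`j(E_{m,n}) = (q (289q − 48r))³ / (225 m q³ r²)`** (Mathlib `j = Δ'⁻¹ c₄³`).
[cite: SilvermanAEC2009, III §1 (j = c₄³/Δ)] -/
theorem curve_j (j n : ℤ) [(curve j n).IsElliptic] :
    (curve j n).j = (((qOf j n * (289 * qOf j n - 48 * rOf j n)) ^ 3 : ℤ) : ℚ) /
      ((225 * mOf j * qOf j n ^ 3 * rOf j n ^ 2 : ℤ) : ℚ) := by
  rw [WeierstrassCurve.j, Units.val_inv_eq_inv_val, WeierstrassCurve.coe_Δ', curve_c₄, curve_Δ,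
    div_eq_inv_mul]
  push_cast
  ring

/-! ### §2 The valuation of `j(E_{m,n})` at `r` is `−2` -/

/-- For admissible `(j, n)`: `v_r(j(E)) = −2` at the prime `r = m + 289 n²`. [cite: SilvermanAEC2009, Prop. VII.5.5 (v(j) < 0)] -/
theorem padicValRat_j_eq_neg_two {j n : ℤ} (hA : AdmissibleF j n) [(curve j n).IsElliptic]
    [Fact (rOf j n).natAbs.Prime] :
    padicValRat (rOf j n).natAbs (curve j n).j = -2 := by
  obtain ⟨hj, hm, hn, -, hq, hr⟩ := id hA
  -- the natural-number avatars
  have hm0 : 0 < mOf j := by unfold mOf; omega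
  have hq0 : 0 < qOf j n := by unfold qOf; nlinarith [sq_nonneg n]
  have hr0 : 0 < rOf j n := by unfold rOf; nlinarith [sq_nonneg n]
  set M : ℕ := (mOf j).natAbs with hMdef
  set Q : ℕ := (qOf j n).natAbs with hQdef
  set R : ℕ := (rOf j n).natAbs with hRdef
  set N : ℕ := n.natAbs with hNdef
  have hMZ : (M : ℤ) = mOf j := Int.natAbs_of_nonneg hm0.le
  have hQZ : (Q : ℤ) = qOf j n := Int.natAbs_of_nonneg hq0.le
  have hRZ : (R : ℤ) = rOf j n := Int.natAbs_of_nonneg hr0.le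
  have hNZ : ((N : ℤ)) ^ 2 = n ^ 2 := by rw [hNdef, Int.natAbs_sq]
  have hm' : M.Prime := Int.prime_iff_natAbs_prime.mp hm
  have hq' : Q.Prime := Int.prime_iff_natAbs_prime.mp hq
  have hr' : R.Prime := Int.prime_iff_natAbs_prime.mp hr
  have hMpos : 0 < M := hm'.pos
  have hQpos : 0 < Q := hq'.pos
  have hRpos : 0 < R := hr'.pos
  -- relations in ℕ: `Q = M + 64 N²`, `R = M + 289 N²`, `289 Q = (241 M + 4624 N²) + 48 R`
  have hQe : (Q : ℤ) = M + 64 * (N : ℤ) ^ 2 := by rw [hQZ, hMZ, hNZ]; unfold qOf mOf; ring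
  have hRe : (R : ℤ) = M + 289 * (N : ℤ) ^ 2 := by rw [hRZ, hMZ, hNZ]; unfold rOf mOf; ring
  have hQnat : Q = M + 64 * N ^ 2 := by exact_mod_cast hQe
  have hRnat : R = M + 289 * N ^ 2 := by exact_mod_cast hRe
  have hN0 : 0 < N := Int.natAbs_pos.mpr hn
  have hN60 : 60 ≤ N := by
    obtain ⟨k, hk⟩ := hA.2.2.2.1
    have : N = 60 * k.natAbs := by rw [hNdef, hk, Int.natAbs_mul]; rfl
    have hk0 : k ≠ 0 := by rintro rfl; simp at hk; exact hn hk
    have := Int.natAbs_pos.mpr hk0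
    omega
  set L : ℕ := 241 * M + 4624 * N ^ 2 with hLdef
  have hLpos : 0 < L := by positivity
  have hrel : 289 * Q = L + 48 * R := by rw [hLdef, hQnat, hRnat]; ring
  -- `j` as a quotient of naturals
  have hsub : 289 * qOf j n - 48 * rOf j n = (L : ℤ) := by
    rw [sub_eq_lin, hLdef]; push_cast; rw [hMZ.symm, ← hNZ]
  have hjQ : (curve j n).j = (((Q * L) ^ 3 : ℕ) : ℚ) / ((225 * M * Q ^ 3 * R ^ 2 : ℕ) : ℚ) := by
    rw [curve_j, hsub, ← hQZ, ← hMZ, ← hRZ]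
    push_cast
    ring
  -- `R` divides none of `Q`, `M`, `225`, `L`
  have hRgt : 289 < R := by
    have : 289 * 60 ^ 2 ≤ 289 * N ^ 2 := Nat.mul_le_mul_left _ (Nat.pow_le_pow_left hN60 2)
    omega
  have hRM : R ≠ M := by
    have : 0 < 289 * N ^ 2 := by positivity
    omega
  have hRQ : R ≠ Q := by
    have : 64 * N ^ 2 < 289 * N ^ 2 := by
      have := Nat.pow_pos (n := 2) hN0; omega
    omega
  haveI : Fact R.Prime := ⟨hr'⟩
  have vM : padicValNat R M = 0 := by
    haveI : Fact M.Prime := ⟨hm'⟩; exact padicValNat_primes hRM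
  have vQ : padicValNat R Q = 0 := by
    haveI : Fact Q.Prime := ⟨hq'⟩; exact padicValNat_primes hRQ
  have v225 : padicValNat R 225 = 0 := by
    refine padicValNat.eq_zero_of_not_dvd fun h ↦ ?_
    have := Nat.le_of_dvd (by norm_num) h
    omega
  have vL : padicValNat R L = 0 := by
    refine padicValNat.eq_zero_of_not_dvd fun hL ↦ ?_
    -- `R ∣ L` and `R ∣ 48 R` give `R ∣ 289 Q`, so `R ∣ 289` or `R ∣ Q`
    have h289Q : R ∣ 289 * Q := by rw [hrel]; exact dvd_add hL (dvd_mul_left R 48)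
    rcases (Nat.Prime.dvd_mul hr').mp h289Q with h1 | h2
    · have := Nat.le_of_dvd (by norm_num) h1; omega
    · exact hRQ ((Nat.prime_dvd_prime_iff_eq hr' hq').mp h2)
  have vR : padicValNat R R = 1 := padicValNat_self
  -- assemble
  have hnum0 : ((Q * L) ^ 3 : ℕ) ≠ 0 := by positivity
  have hden0 : (225 * M * Q ^ 3 * R ^ 2 : ℕ) ≠ 0 := by positivity
  have vnum : padicValNat R ((Q * L) ^ 3) = 0 := by
    rw [padicValNat.pow, padicValNat.mul hQpos.ne' hLpos.ne', vQ, vL]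
  have vden : padicValNat R (225 * M * Q ^ 3 * R ^ 2) = 2 := by
    rw [padicValNat.mul (by positivity) (by positivity), padicValNat.mul (by positivity) (by positivity),
      padicValNat.mul (by positivity) (by positivity), padicValNat.pow, padicValNat.pow, v225, vM, vQ, vR]
  rw [hjQ, padicValRat.div (by exact_mod_cast hnum0) (by exact_mod_cast hden0), padicValRat.of_nat,
    padicValRat.of_nat, vnum, vden]
  norm_num

/-- **`‖j(E_{m,n})‖_r = r² > 1`** for admissible `(j, n)`. [cite: SilvermanAEC2009, Prop. VII.5.5] -/
theorem one_lt_norm_j {j n : ℤ} (hA : AdmissibleF j n) [(curve j n).IsElliptic]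
    [Fact (rOf j n).natAbs.Prime] :
    1 < ‖((curve j n).j : ℚ_[(rOf j n).natAbs])‖ := by
  have hv := padicValRat_j_eq_neg_two hA
  have hj0 : (curve j n).j ≠ 0 := by
    intro h0
    rw [h0, padicValRat.zero] at hv
    norm_num at hv
  rw [Padic.eq_padicNorm, padicNorm.eq_zpow_of_nonzero hj0, hv, neg_neg]
  have hp : (1 : ℚ) < (rOf j n).natAbs := by exact_mod_cast (Fact.out : (rOf j n).natAbs.Prime).one_lt
  have h2 : (1 : ℚ) < ((rOf j n).natAbs : ℚ) ^ (2 : ℤ) := one_lt_zpow₀ hp (by norm_num)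
  exact_mod_cast h2

end Summit.BirchSwinnertonDyer.Rank2.Family81517

namespace Summit.BirchSwinnertonDyer.Rank2.LambdaTransportDoor

open Summit.BirchSwinnertonDyer.Rank2.Family81517

/-- **`MembersNonCM` HOLDS**: no admissible member `E_{m,n}` of the `8-15-17` family has complex
multiplication — `‖j(E)‖_r = r² > 1` at the prime `r = m + 289n²` (`Family81517.one_lt_norm_j`), while a
CM curve over `ℚ` has integral `j` (tree theorem `WeierstrassCurve.not_hasCM_of_one_lt_norm_j`, Silverman
*ATAEC* II.6.1). One of the displayed inputs of `selmerCorankEqOrderEqThreeOnOddFamily_of_19272`, discharged.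
[cite: SilvermanATAEC1994, Thm. II.6.1] [cite: SilvermanAEC2009, Prop. VII.5.5] -/
theorem membersNonCM_holds : MembersNonCM := by
  intro j n hA hE
  haveI := hE
  haveI : Fact (rOf j n).natAbs.Prime := ⟨Int.prime_iff_natAbs_prime.mp hA.2.2.2.2.2⟩
  exact WeierstrassCurve.not_hasCM_of_one_lt_norm_j (curve j n) (one_lt_norm_j hA)

end Summit.BirchSwinnertonDyer.Rank2.LambdaTransportDoor

end
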